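import Summits.QuantumFields.YangMills.Theorems.BalabanUVNodesN21CollarOdds
import Summits.QuantumFields.YangMills.Theorems.BalabanUVNodesN21DilationRadialInputs
import Mathlib.Analysis.SpecialFunctions.Gaussian.GaussianIntegral
import Mathlib.MeasureTheory.Integral.Pi

/-!
# N21 (NE7c) · PRODUCT OF COLLAR ODDS: the `m` dropped `≥`-cuts of one sent component ride in ONE envelope at odds
# `∏ᵢ (1 + Qᵢ) − 1 ≤ (1 + Q₀)^m − 1` — the middle of the roads' junction (lens Card 71 ∕ ROW C)

R141 (C) seat pub-ymgap-dag-n21-e (g14), node N21 = NE7c (single-run shell-weight bound, NOT PRINTED in [Bałaban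
1983–89], NOT proved), strategy s3 ALTERNATIVE CURRENCY, lane K3⁷ `SpineGivenEndpointR13SepCoPH`
(stmt-QuantumFields-20544, `--kind proof --supports … --as helper`).  Part 38i of this seat's series.

WHY.  At the Γ-collar the two N21 roads meet (lens `ym-lens-BalabanUVNodes-nearmiss` v24.0 Card 71 ∕ ROW C): road II
(n21-d, inward dilation) exits every DROPPED `≥`-cut `{bᵢ ≤ uᵢ}` of a sent component into its left shell `[aᵢ, bᵢ)`,
and G19 `…N21DilationTransversal.slotAntiConcentration_restrict_of_radialTransversal` wants ONE odds number for the
whole envelope excess, `hQ : ν(Env ∖ P) ≤ Q·ν(P)`; road I (this seat, 38h `…N21CollarChargeByCounting`, p565329) books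
`(1+Q₀)^m` for a component with `m` collar blocks and charges `m·log(1+Q₀)` against the per-cube currency by counting.
The typed producer of `Q₀`, n21-d G21 `…N21CollarOdds.collarOdds_of_partialSlope` (p564977) over part 9
`…N21GibbsBlockSupHazard.measure_coordSlice_le_of_partialSlope`, gives ONE block conditionally on a SUB-LEVEL event
`{x_q < t_q, q ≠ p}` of the other coordinates; iterating over the `m` blocks conditions block `i` on the `≥`-events
`{b_j ≤ x_j}` already processed — NOT sub-level — so the product is not an instance of the single-block statements AS
TYPED.  This file types the iteration, abstractly and in G21's Gibbs-coordinates model, from part 9's GENERAL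
`measure_coordSlice_le_of_fibrewise` (any event not reading `x_p`), part 8's one-dimensional device and G21 §1 BY NAME.
* §1 (any measure space) ★ `measure_biInter_env_le_prod_of_condOdds`: a «not read by block `i`» predicate `NR i ·`
  given as a HYPOTHESIS-PARAMETRISED variable closed under `P_j ∩ ·`, `E_j ∩ ·` (`j ≠ i`), per-block conditional
  odds `ν((Eᵢ ∖ Pᵢ) ∩ C) ≤ Qᵢ·ν(Pᵢ ∩ C)` for every `C` with `NR i C` ⇒ `ν((⋂ᵢ Eᵢ) ∩ R) ≤ ∏ᵢ (1+Qᵢ) · ν((⋂ᵢ Pᵢ) ∩ R)`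
  for every rest event `R` read by no block (Finset induction, the rest absorbing the processed supports);
  `…_diff_…` = G19's `hQ` SHAPE with `Q = ∏ᵢ(1+Qᵢ) − 1`; `prod_one_add_le_pow_card` = 38h §1's
  `(1+Q₀)^m` handshake (`hqc` binder of `charge_le_of_parts_collar`).
* §2 (`ν = e^{−A} dx` on `ℝ^ι`) `measure_coordSlice_le_of_partialSlope_of_notRead` (part 9 for ANY measurable `C`
  not reading `x_p`), `condOdds_coord_of_partialSlope` (G21 §2 likewise — G21's is the sub-level instance),
  ★★ `collarOddsProduct_of_partialSlopes` (the `m`-block product), `collarOddsProduct_le_pow`, ★ `envelopeOdds_of_collars`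
  (G19's difference form, `Q = (1+Q₀)^{#M} − 1`).
* §3 `smul_mem_biInter_geCut_env` ∕ `…_halfspace`: G20 `smul_mem_geCut_env` per cut — inward dilates of
  `⋂ᵢ {θᵢ ≤ uᵢ}` land in `⋂ᵢ {(1−τ)θᵢ − τc₀ᵢ ≤ uᵢ}` = the `⋂ᵢ Eᵢ` of §1∕§2 (`aᵢ := (1−τ)θᵢ − τc₀ᵢ`, `bᵢ := θᵢ`).
* §4 A6 witness (director-ym STANDING A6 RULE №189 (3)) on the Gaussian weight `A = Σᵢ xᵢ²∕2` (n21-d G22's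
  family): `isFiniteMeasure_gaussianWeight`, `gaussianWeight_partialSlope` (`Λ = 2` on `[0, 1∕6)`),
  ★ `collarOddsProduct_binders_inhabited` — §2's END applied with every binder discharged in the kernel.

HONEST FRAMING.  [textbook] measure theory (iterated conditioning ∕ Tonelli) + real arithmetic; 0 def, 0 sorry; the
slopes `Λᵢ`, shells `[aᵢ, bᵢ)` and the not-read structure of the rest event are HYPOTHESES (NODE O's term object ∕
n21-d's hazard numbers), never estimated here; nothing of Bałaban's asserted ([Balaban1989LargeFieldI] p. 176 ∕ p. 193
= the located MECHANISM only); NE7c NOT PRINTED ∕ NOT proved; N21 NOT discharged; counts unmoved (typed 28∕28 ·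
discharged 5∕27); count-neutral; one finite 𝕋⁴ at fixed ε — nothing about ℝ⁴ ∕ OS ∕ mass gap ∕ Clay.
-/

set_option autoImplicit false

open MeasureTheory Set Function
open scoped ENNReal

namespace Summit.QuantumFields.YangMills.Theorems.N21CollarOddsProduct

open Summit.QuantumFields.YangMills.Theorems.N21CollarOdds (measure_shell_inter_le_odds_of_condHazard)
open Summit.QuantumFields.YangMills.Theorems.N21GibbsBlockSupHazard (measure_coordSlice_le_of_fibrewise)
open Summit.QuantumFields.YangMills.Theorems.N21HazardFromLogLipschitz (withDensity_exp_neg_Ico_le_of_logLipschitz)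
open Summit.QuantumFields.YangMills.Theorems.N21DilationRadialInputs (smul_mem_geCut_env)

/-! ## §1 The abstract product of conditional odds over a finite set of blocks -/

section Abstract

variable {Ω : Type*} [MeasurableSpace Ω] (ν : Measure Ω)

/-- **ONE BLOCK, CONDITIONED.**  `0 ≤ Q` and `ν((E ∖ P) ∩ C) ≤ Q·ν(P ∩ C)` give
`ν(E ∩ C) ≤ (1+Q)·ν(P ∩ C)` (G19 `measure_env_le_of_odds` is the instance `C = univ`, stated on `Env ∖ P`). [textbook] -/
theorem measure_inter_env_le_of_condOdds {P E C : Set Ω} {Q : ℝ} (hQ0 : 0 ≤ Q)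
    (h : ν ((E \ P) ∩ C) ≤ ENNReal.ofReal Q * ν (P ∩ C)) :
    ν (E ∩ C) ≤ ENNReal.ofReal (1 + Q) * ν (P ∩ C) := by
  have hsub : E ∩ C ⊆ (P ∩ C) ∪ ((E \ P) ∩ C) := fun x hx => by
    by_cases hp : x ∈ P
    exacts [Or.inl ⟨hp, hx.2⟩, Or.inr ⟨⟨hx.1, hp⟩, hx.2⟩]
  calc ν (E ∩ C) ≤ ν ((P ∩ C) ∪ ((E \ P) ∩ C)) := measure_mono hsub
    _ ≤ ν (P ∩ C) + ν ((E \ P) ∩ C) := measure_union_le _ _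
    _ ≤ ν (P ∩ C) + ENNReal.ofReal Q * ν (P ∩ C) := add_le_add le_rfl h
    _ = ENNReal.ofReal (1 + Q) * ν (P ∩ C) := by
        rw [ENNReal.ofReal_add zero_le_one hQ0, ENNReal.ofReal_one, add_mul, one_mul]

variable {β : Type*} [DecidableEq β]

omit [MeasurableSpace Ω] in
/-- closure bookkeeping: if the rest event `R` is not read by block `i` and intersecting with any `F j`, `j ∈ s`,
preserves that, then `(⋂_{j ∈ s} F j) ∩ R` is not read by `i`. [textbook] -/
theorem notRead_biInter_inter (NR : β → Set Ω → Prop) (F : β → Set Ω) {i : β} (s : Finset β)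
    (hF : ∀ j ∈ s, ∀ C, NR i C → NR i (F j ∩ C)) {R : Set Ω} (hR : NR i R) :
    NR i ((⋂ j ∈ s, F j) ∩ R) := by
  induction s using Finset.induction_on with
  | empty => simpa using hR
  | insert a s ha ih =>
    have h1 : NR i ((⋂ j ∈ s, F j) ∩ R) := ih fun j hj => hF j (Finset.mem_insert_of_mem hj)
    have h2 := hF a (Finset.mem_insert_self a s) _ h1
    rwa [Finset.set_biInter_insert, inter_assoc]

/-- **THE PRODUCT OF CONDITIONAL ODDS.**  Blocks `i ∈ M` with supports `Pᵢ`, envelopes `Eᵢ` and odds `Qᵢ ≥ 0`; a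
«not read by block `i`» predicate `NR i ·` on events, closed under intersection with the OTHER blocks' `P_j`, `E_j`;
per block, for every event `C` not read by it, the conditional odds bound `ν((Eᵢ ∖ Pᵢ) ∩ C) ≤ Qᵢ·ν(Pᵢ ∩ C)`.  Then for
every rest event `R` read by no block of `M`:
`ν((⋂_{i∈M} Eᵢ) ∩ R) ≤ (∏_{i∈M} (1 + Qᵢ)) · ν((⋂_{i∈M} Pᵢ) ∩ R)` — peel one block, condition it on the other
envelopes and the rest, and absorb its support into the rest for the induction. [textbook] -/
theorem measure_biInter_env_le_prod_of_condOdds (P E : β → Set Ω) (Q : β → ℝ) (NR : β → Set Ω → Prop)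
    (M : Finset β) (hQ0 : ∀ i ∈ M, 0 ≤ Q i)
    (hNP : ∀ i ∈ M, ∀ j ∈ M, j ≠ i → ∀ C, NR i C → NR i (P j ∩ C))
    (hNE : ∀ i ∈ M, ∀ j ∈ M, j ≠ i → ∀ C, NR i C → NR i (E j ∩ C))
    (hodds : ∀ i ∈ M, ∀ C, NR i C → ν ((E i \ P i) ∩ C) ≤ ENNReal.ofReal (Q i) * ν (P i ∩ C))
    {R : Set Ω} (hR : ∀ i ∈ M, NR i R) :
    ν ((⋂ i ∈ M, E i) ∩ R) ≤ ENNReal.ofReal (∏ i ∈ M, (1 + Q i)) * ν ((⋂ i ∈ M, P i) ∩ R) := by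
  induction M using Finset.induction_on generalizing R with
  | empty => simp
  | insert a s ha ih =>
    have has : a ∈ insert a s := Finset.mem_insert_self a s
    have hss : ∀ j ∈ s, j ∈ insert a s := fun j hj => Finset.mem_insert_of_mem hj
    have hne : ∀ j ∈ s, j ≠ a := fun j hj h => ha (h ▸ hj)
    -- condition block `a` on the other envelopes and the rest
    have hC : NR a ((⋂ j ∈ s, E j) ∩ R) :=
      notRead_biInter_inter NR E s (fun j hj C hCj => hNE a has j (hss j hj) (hne j hj) C hCj) (hR a has)
    have h1 : ν (E a ∩ ((⋂ j ∈ s, E j) ∩ R))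
        ≤ ENNReal.ofReal (1 + Q a) * ν (P a ∩ ((⋂ j ∈ s, E j) ∩ R)) :=
      measure_inter_env_le_of_condOdds ν (hQ0 a has) (hodds a has _ hC)
    -- absorb the support `P a` into the rest and use the induction hypothesis
    have hR' : ∀ i ∈ s, NR i (P a ∩ R) := fun i hi =>
      hNP i (hss i hi) a has (fun h => ha (h ▸ hi)) R (hR i (hss i hi))
    have h2 := ih (fun i hi => hQ0 i (hss i hi))
      (fun i hi j hj => hNP i (hss i hi) j (hss j hj)) (fun i hi j hj => hNE i (hss i hi) j (hss j hj))
      (fun i hi => hodds i (hss i hi)) hR'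
    have e2 : P a ∩ ((⋂ j ∈ s, E j) ∩ R) = (⋂ j ∈ s, E j) ∩ (P a ∩ R) := inter_left_comm _ _ _
    have e3 : (⋂ j ∈ s, P j) ∩ (P a ∩ R) = (⋂ j ∈ insert a s, P j) ∩ R := by
      rw [Finset.set_biInter_insert, inter_left_comm, inter_assoc]
    have hprod0 : 0 ≤ ∏ i ∈ s, (1 + Q i) :=
      Finset.prod_nonneg fun i hi => by linarith [hQ0 i (hss i hi)]
    rw [Finset.set_biInter_insert, inter_assoc, Finset.prod_insert ha,
      ENNReal.ofReal_mul (by linarith [hQ0 a has]), mul_assoc, ← e3]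
    calc ν (E a ∩ ((⋂ j ∈ s, E j) ∩ R))
        ≤ ENNReal.ofReal (1 + Q a) * ν (P a ∩ ((⋂ j ∈ s, E j) ∩ R)) := h1
      _ = ENNReal.ofReal (1 + Q a) * ν ((⋂ j ∈ s, E j) ∩ (P a ∩ R)) := by rw [e2]
      _ ≤ ENNReal.ofReal (1 + Q a) *
            (ENNReal.ofReal (∏ i ∈ s, (1 + Q i)) * ν ((⋂ j ∈ s, P j) ∩ (P a ∩ R))) :=
          mul_le_mul_right h2 _

/-- **THE ENVELOPE'S EXCESS IN G19's SHAPE.**  Under the hypotheses of `measure_biInter_env_le_prod_of_condOdds`, with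
the support event `(⋂ᵢ Pᵢ) ∩ R` measurable and of finite mass:
`ν(((⋂ᵢ Eᵢ) ∩ R) ∖ ((⋂ᵢ Pᵢ) ∩ R)) ≤ (∏ᵢ (1+Qᵢ) − 1) · ν((⋂ᵢ Pᵢ) ∩ R)` — the `hQ` binder of
`…N21DilationTransversal.slotAntiConcentration_restrict_of_radialTransversal` with `Env = (⋂ᵢ Eᵢ) ∩ R`,
`P = (⋂ᵢ Pᵢ) ∩ R`, `Q = ∏ᵢ (1+Qᵢ) − 1`. [textbook] -/
theorem measure_biInter_env_diff_le_of_condOdds (P E : β → Set Ω) (Q : β → ℝ) (NR : β → Set Ω → Prop)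
    (M : Finset β) (hPE : ∀ i ∈ M, P i ⊆ E i) (hQ0 : ∀ i ∈ M, 0 ≤ Q i)
    (hNP : ∀ i ∈ M, ∀ j ∈ M, j ≠ i → ∀ C, NR i C → NR i (P j ∩ C))
    (hNE : ∀ i ∈ M, ∀ j ∈ M, j ≠ i → ∀ C, NR i C → NR i (E j ∩ C))
    (hodds : ∀ i ∈ M, ∀ C, NR i C → ν ((E i \ P i) ∩ C) ≤ ENNReal.ofReal (Q i) * ν (P i ∩ C))
    {R : Set Ω} (hR : ∀ i ∈ M, NR i R) (hmeas : MeasurableSet ((⋂ i ∈ M, P i) ∩ R))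
    (hfin : ν ((⋂ i ∈ M, P i) ∩ R) ≠ ∞) :
    ν (((⋂ i ∈ M, E i) ∩ R) \ ((⋂ i ∈ M, P i) ∩ R))
      ≤ ENNReal.ofReal (∏ i ∈ M, (1 + Q i) - 1) * ν ((⋂ i ∈ M, P i) ∩ R) := by
  have hsub : (⋂ i ∈ M, P i) ∩ R ⊆ (⋂ i ∈ M, E i) ∩ R :=
    inter_subset_inter_left _ (iInter₂_mono fun i hi => hPE i hi)
  have h := measure_biInter_env_le_prod_of_condOdds ν P E Q NR M hQ0 hNP hNE hodds hR
  rw [measure_sdiff hsub hmeas.nullMeasurableSet hfin, ENNReal.ofReal_sub _ zero_le_one, ENNReal.ofReal_one,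
    ENNReal.sub_mul (fun _ _ => hfin), one_mul]
  exact tsub_le_tsub_right h _

omit [DecidableEq β] in
/-- **38h §1's HANDSHAKE**: block odds `Qᵢ ≤ Q₀` give `∏_{i∈M} (1+Qᵢ) ≤ (1+Q₀)^{#M}` — the factor `(1+Q₀)^m`,
`m = #M` collar blocks, that `…N21CollarChargeByCounting.collar_component_bound` books per component (times
`q_□^k ≥ 0` it is the `hqc` binder of `charge_le_of_parts_collar` ∕ `charge_le_of_liveWindow_collar`). [textbook] -/
theorem prod_one_add_le_pow_card (M : Finset β) {Q : β → ℝ} {Q₀ : ℝ} (hQ0 : ∀ i ∈ M, 0 ≤ Q i)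
    (hle : ∀ i ∈ M, Q i ≤ Q₀) : ∏ i ∈ M, (1 + Q i) ≤ (1 + Q₀) ^ M.card := by
  calc ∏ i ∈ M, (1 + Q i) ≤ ∏ _i ∈ M, (1 + Q₀) :=
        Finset.prod_le_prod (fun i hi => by linarith [hQ0 i hi]) fun i hi => by linarith [hle i hi]
    _ = (1 + Q₀) ^ M.card := Finset.prod_const _

end Abstract

/-! ## §2 The product of collar odds in Gibbs coordinates (G21's model) -/

section Gibbs

variable {ι : Type*} [Fintype ι] [DecidableEq ι]

/-- **PART 9 FOR ANY EVENT NOT READING THE COORDINATE.**  `ν = e^{−A} dx` on `ℝ^ι`, `A` measurable, one-sided partial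
slope `≤ Λ` along `x_p` on the right `Λ⁻¹`-neighbourhoods of `[a, b)` (uniformly in the other coordinates); `C`
measurable with `(x with x_p := y) ∈ C ↔ x ∈ C`.  Then `ν({a ≤ x_p < b} ∩ C) ≤ e·Λ·(b − a) · ν({a ≤ x_p} ∩ C)` —
part 8 `withDensity_exp_neg_Ico_le_of_logLipschitz` on every `p`-fibre + part 9 `measure_coordSlice_le_of_fibrewise`
(part 9's `measure_coordSlice_le_of_partialSlope` is the sub-level instance `C = {x_q < t_q, q ≠ p}`). [textbook] -/
theorem measure_coordSlice_le_of_partialSlope_of_notRead {A : (ι → ℝ) → ℝ} (hA : Measurable A) (p : ι)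
    {a b Λ : ℝ} (hΛ : 0 < Λ)
    (hslope : ∀ x : ι → ℝ, ∀ y₁ ∈ Ico a b, ∀ y₂ ∈ Icc y₁ (y₁ + Λ⁻¹),
      A (update x p y₂) - A (update x p y₁) ≤ Λ * (y₂ - y₁))
    {C : Set (ι → ℝ)} (hC : MeasurableSet C) (hCp : ∀ x y, update x p y ∈ C ↔ x ∈ C) :
    (volume.withDensity fun x : ι → ℝ => ENNReal.ofReal (Real.exp (-A x))) ({x | a ≤ x p ∧ x p < b} ∩ C)
      ≤ ENNReal.ofReal (Real.exp 1 * Λ * (b - a)) *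
        (volume.withDensity fun x : ι → ℝ => ENNReal.ofReal (Real.exp (-A x))) ({x | a ≤ x p} ∩ C) := by
  have hg : Measurable fun x : ι → ℝ => ENNReal.ofReal (Real.exp (-A x)) :=
    ENNReal.measurable_ofReal.comp (Real.measurable_exp.comp hA.neg)
  have hfib : ∀ x : ι → ℝ, ∫⁻ y in Ico a b, ENNReal.ofReal (Real.exp (-A (update x p y)))
      ≤ ENNReal.ofReal (Real.exp 1 * Λ * (b - a)) *
        ∫⁻ y in Ici a, ENNReal.ofReal (Real.exp (-A (update x p y))) := by
    intro x
    have hW : Measurable fun y => A (update x p y) := hA.comp (measurable_update x)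
    have h := withDensity_exp_neg_Ico_le_of_logLipschitz hW hΛ (fun y₁ hy₁ y₂ hy₂ => hslope x y₁ hy₁ y₂ hy₂)
    rwa [withDensity_apply _ measurableSet_Ico, withDensity_apply _ measurableSet_Ici] at h
  exact measure_coordSlice_le_of_fibrewise hg p measurableSet_Ico measurableSet_Ici _ ENNReal.ofReal_ne_top hfib
    hC hCp

/-- **G21 §2 FOR ANY EVENT NOT READING THE COORDINATE.**  Same data with `e^{−A}` of finite mass, `a ≤ b` and
`c := e·Λ·(b − a) < 1`: `ν({a ≤ x_p < b} ∩ C) ≤ c∕(1−c) · ν({b ≤ x_p} ∩ C)` (G21 §1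
`measure_shell_inter_le_odds_of_condHazard` BY NAME; G21's `collarOdds_of_partialSlope` is the sub-level instance). [textbook] -/
theorem condOdds_coord_of_partialSlope {A : (ι → ℝ) → ℝ} (hA : Measurable A)
    [IsFiniteMeasure (volume.withDensity fun x : ι → ℝ => ENNReal.ofReal (Real.exp (-A x)))]
    (p : ι) {a b Λ : ℝ} (hΛ : 0 < Λ) (hab : a ≤ b) (hc1 : Real.exp 1 * Λ * (b - a) < 1)
    (hslope : ∀ x : ι → ℝ, ∀ y₁ ∈ Ico a b, ∀ y₂ ∈ Icc y₁ (y₁ + Λ⁻¹),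
      A (update x p y₂) - A (update x p y₁) ≤ Λ * (y₂ - y₁))
    {C : Set (ι → ℝ)} (hC : MeasurableSet C) (hCp : ∀ x y, update x p y ∈ C ↔ x ∈ C) :
    (volume.withDensity fun x : ι → ℝ => ENNReal.ofReal (Real.exp (-A x))) ({x | a ≤ x p ∧ x p < b} ∩ C)
      ≤ ENNReal.ofReal (Real.exp 1 * Λ * (b - a) / (1 - Real.exp 1 * Λ * (b - a))) *
        (volume.withDensity fun x : ι → ℝ => ENNReal.ofReal (Real.exp (-A x))) ({x | b ≤ x p} ∩ C) := by
  have hc0 : 0 ≤ Real.exp 1 * Λ * (b - a) :=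
    mul_nonneg (mul_nonneg (Real.exp_pos 1).le hΛ.le) (sub_nonneg.2 hab)
  exact measure_shell_inter_le_odds_of_condHazard _ (measurable_pi_apply p) _ hc0 hc1
    (measure_coordSlice_le_of_partialSlope_of_notRead hA p hΛ hslope hC hCp)

/-- **THE PRODUCT OF COLLAR ODDS** (lens Card 71's `Q''` for a component with SEVERAL collar blocks).  `ν = e^{−A} dx`
on `ℝ^ι` of finite mass; collar coordinates `M : Finset ι`, each with its left shell `[aᵢ, bᵢ)` below its `≥`-cut
`{bᵢ ≤ xᵢ}`, a one-sided partial slope `Λᵢ > 0` along `xᵢ` there (uniformly in the other coordinates) and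
`cᵢ := e·Λᵢ·(bᵢ − aᵢ) < 1`; `R` any measurable rest event reading no collar coordinate.  Then
`ν((⋂_{i∈M} {aᵢ ≤ xᵢ}) ∩ R) ≤ ∏_{i∈M} (1 + cᵢ∕(1−cᵢ)) · ν((⋂_{i∈M} {bᵢ ≤ xᵢ}) ∩ R)`: the `m` dropped cuts of
one sent component ride in ONE envelope. [textbook] -/
theorem collarOddsProduct_of_partialSlopes {A : (ι → ℝ) → ℝ} (hA : Measurable A)
    [IsFiniteMeasure (volume.withDensity fun x : ι → ℝ => ENNReal.ofReal (Real.exp (-A x)))]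
    (M : Finset ι) {a b Λ : ι → ℝ} (hΛ : ∀ i ∈ M, 0 < Λ i) (hab : ∀ i ∈ M, a i ≤ b i)
    (hc1 : ∀ i ∈ M, Real.exp 1 * Λ i * (b i - a i) < 1)
    (hslope : ∀ i ∈ M, ∀ x : ι → ℝ, ∀ y₁ ∈ Ico (a i) (b i), ∀ y₂ ∈ Icc y₁ (y₁ + (Λ i)⁻¹),
      A (update x i y₂) - A (update x i y₁) ≤ Λ i * (y₂ - y₁))
    {R : Set (ι → ℝ)} (hRm : MeasurableSet R) (hR : ∀ i ∈ M, ∀ x y, update x i y ∈ R ↔ x ∈ R) :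
    (volume.withDensity fun x : ι → ℝ => ENNReal.ofReal (Real.exp (-A x))) ((⋂ i ∈ M, {x | a i ≤ x i}) ∩ R)
      ≤ ENNReal.ofReal (∏ i ∈ M, (1 + Real.exp 1 * Λ i * (b i - a i) / (1 - Real.exp 1 * Λ i * (b i - a i)))) *
        (volume.withDensity fun x : ι → ℝ => ENNReal.ofReal (Real.exp (-A x))) ((⋂ i ∈ M, {x | b i ≤ x i}) ∩ R) := by
  have hc0 : ∀ i ∈ M, 0 ≤ Real.exp 1 * Λ i * (b i - a i) := fun i hi =>
    mul_nonneg (mul_nonneg (Real.exp_pos 1).le (hΛ i hi).le) (sub_nonneg.2 (hab i hi))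
  refine measure_biInter_env_le_prod_of_condOdds _ (fun i => {x : ι → ℝ | b i ≤ x i})
    (fun i => {x : ι → ℝ | a i ≤ x i}) _
    (fun i C => MeasurableSet C ∧ ∀ (x : ι → ℝ) (y : ℝ), update x i y ∈ C ↔ x ∈ C) M
    (fun i hi => div_nonneg (hc0 i hi) (sub_nonneg.2 (hc1 i hi).le)) ?_ ?_ ?_ (fun i hi => ⟨hRm, hR i hi⟩)
  · rintro i - j - hji C ⟨hCm, hCi⟩
    refine ⟨(measurableSet_le measurable_const (measurable_pi_apply j)).inter hCm, fun x y => ?_⟩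
    simp only [mem_inter_iff, mem_setOf_eq, update_of_ne hji, hCi]
  · rintro i - j - hji C ⟨hCm, hCi⟩
    refine ⟨(measurableSet_le measurable_const (measurable_pi_apply j)).inter hCm, fun x y => ?_⟩
    simp only [mem_inter_iff, mem_setOf_eq, update_of_ne hji, hCi]
  · rintro i hi C ⟨hCm, hCi⟩
    have hEP : ({x : ι → ℝ | a i ≤ x i} \ {x | b i ≤ x i}) = {x | a i ≤ x i ∧ x i < b i} := by
      ext x; simp only [mem_sdiff, mem_setOf_eq, not_le]
    rw [hEP]
    exact condOdds_coord_of_partialSlope hA i (hΛ i hi) (hab i hi) (hc1 i hi) (hslope i hi) hCm hCi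

/-- **… WITH A UNIFORM ODDS BOUND**: block odds `cᵢ∕(1−cᵢ) ≤ Q₀` give the factor `(1+Q₀)^{#M}` (38h §1's shape). [textbook] -/
theorem collarOddsProduct_le_pow {A : (ι → ℝ) → ℝ} (hA : Measurable A)
    [IsFiniteMeasure (volume.withDensity fun x : ι → ℝ => ENNReal.ofReal (Real.exp (-A x)))]
    (M : Finset ι) {a b Λ : ι → ℝ} {Q₀ : ℝ} (hΛ : ∀ i ∈ M, 0 < Λ i) (hab : ∀ i ∈ M, a i ≤ b i)
    (hc1 : ∀ i ∈ M, Real.exp 1 * Λ i * (b i - a i) < 1)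
    (hQ₀ : ∀ i ∈ M, Real.exp 1 * Λ i * (b i - a i) / (1 - Real.exp 1 * Λ i * (b i - a i)) ≤ Q₀)
    (hslope : ∀ i ∈ M, ∀ x : ι → ℝ, ∀ y₁ ∈ Ico (a i) (b i), ∀ y₂ ∈ Icc y₁ (y₁ + (Λ i)⁻¹),
      A (update x i y₂) - A (update x i y₁) ≤ Λ i * (y₂ - y₁))
    {R : Set (ι → ℝ)} (hRm : MeasurableSet R) (hR : ∀ i ∈ M, ∀ x y, update x i y ∈ R ↔ x ∈ R) :
    (volume.withDensity fun x : ι → ℝ => ENNReal.ofReal (Real.exp (-A x))) ((⋂ i ∈ M, {x | a i ≤ x i}) ∩ R)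
      ≤ ENNReal.ofReal ((1 + Q₀) ^ M.card) *
        (volume.withDensity fun x : ι → ℝ => ENNReal.ofReal (Real.exp (-A x))) ((⋂ i ∈ M, {x | b i ≤ x i}) ∩ R) := by
  have hQ0 : ∀ i ∈ M, 0 ≤ Real.exp 1 * Λ i * (b i - a i) / (1 - Real.exp 1 * Λ i * (b i - a i)) := fun i hi =>
    div_nonneg (mul_nonneg (mul_nonneg (Real.exp_pos 1).le (hΛ i hi).le) (sub_nonneg.2 (hab i hi)))
      (sub_nonneg.2 (hc1 i hi).le)
  refine (collarOddsProduct_of_partialSlopes hA M hΛ hab hc1 hslope hRm hR).trans ?_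
  gcongr; exact prod_one_add_le_pow_card M hQ0 hQ₀

/-- **THE ENVELOPE ODDS OF THE COLLAR, IN G19's SHAPE.**  Same data: with `P := (⋂_{i∈M} {bᵢ ≤ xᵢ}) ∩ R` (the
component's support inside the rest) and `Env := (⋂_{i∈M} {aᵢ ≤ xᵢ}) ∩ R` (support ∪ left shells, where the inward
dilates land by §3), `ν(Env ∖ P) ≤ ((1+Q₀)^{#M} − 1) · ν(P)` — the `hQ` binder of
`…N21DilationTransversal.slotAntiConcentration_restrict_of_radialTransversal` (its `{U<θ} ∩ C_star` is the rest `R`,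
reading no collar coordinate; its `C = C_star ∩ ⋂ᵢ{bᵢ ≤ xᵢ}`) for `m = #M` dropped `≥`-cuts, whose `(1+Q)` then
reads `(1+Q₀)^m`: the number 38h §1 charges against the per-cube currency by counting. [textbook] -/
theorem envelopeOdds_of_collars {A : (ι → ℝ) → ℝ} (hA : Measurable A)
    [IsFiniteMeasure (volume.withDensity fun x : ι → ℝ => ENNReal.ofReal (Real.exp (-A x)))]
    (M : Finset ι) {a b Λ : ι → ℝ} {Q₀ : ℝ} (hΛ : ∀ i ∈ M, 0 < Λ i) (hab : ∀ i ∈ M, a i ≤ b i)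
    (hc1 : ∀ i ∈ M, Real.exp 1 * Λ i * (b i - a i) < 1)
    (hQ₀ : ∀ i ∈ M, Real.exp 1 * Λ i * (b i - a i) / (1 - Real.exp 1 * Λ i * (b i - a i)) ≤ Q₀)
    (hslope : ∀ i ∈ M, ∀ x : ι → ℝ, ∀ y₁ ∈ Ico (a i) (b i), ∀ y₂ ∈ Icc y₁ (y₁ + (Λ i)⁻¹),
      A (update x i y₂) - A (update x i y₁) ≤ Λ i * (y₂ - y₁))
    {R : Set (ι → ℝ)} (hRm : MeasurableSet R) (hR : ∀ i ∈ M, ∀ x y, update x i y ∈ R ↔ x ∈ R) :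
    (volume.withDensity fun x : ι → ℝ => ENNReal.ofReal (Real.exp (-A x)))
        (((⋂ i ∈ M, {x : ι → ℝ | a i ≤ x i}) ∩ R) \ ((⋂ i ∈ M, {x : ι → ℝ | b i ≤ x i}) ∩ R))
      ≤ ENNReal.ofReal ((1 + Q₀) ^ M.card - 1) *
        (volume.withDensity fun x : ι → ℝ => ENNReal.ofReal (Real.exp (-A x))) ((⋂ i ∈ M, {x | b i ≤ x i}) ∩ R) := by
  have hPm : MeasurableSet ((⋂ i ∈ M, {x : ι → ℝ | b i ≤ x i}) ∩ R) :=
    (Finset.measurableSet_biInter M fun i _ => measurableSet_le measurable_const (measurable_pi_apply i)).inter hRm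
  have hsub : (⋂ i ∈ M, {x : ι → ℝ | b i ≤ x i}) ∩ R ⊆ (⋂ i ∈ M, {x : ι → ℝ | a i ≤ x i}) ∩ R :=
    inter_subset_inter_left _ (iInter₂_mono fun i hi x hx => (hab i hi).trans hx)
  have hfin := measure_ne_top (volume.withDensity fun x : ι → ℝ => ENNReal.ofReal (Real.exp (-A x)))
    ((⋂ i ∈ M, {x : ι → ℝ | b i ≤ x i}) ∩ R)
  rw [measure_sdiff hsub hPm.nullMeasurableSet hfin, ENNReal.ofReal_sub _ zero_le_one, ENNReal.ofReal_one,
    ENNReal.sub_mul (fun _ _ => hfin), one_mul]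
  exact tsub_le_tsub_right (collarOddsProduct_le_pow hA M hΛ hab hc1 hQ₀ hslope hRm hR) _

end Gibbs

/-! ## §3 Where the inward dilates of a component's support land (G20 per cut) -/

section Geometry

variable {X β : Type*} [AddCommGroup X] [Module ℝ X]

/-- **SEVERAL `≥`-CUTS UNDER INWARD DILATION.**  Letters `uᵢ`, `i ∈ M`, with the affine lower scaling
`uᵢ(l•z) ≥ l·uᵢ(z) − (1−l)c₀ᵢ` for `l ∈ [1−τ, 1]` (`τ ≤ 1`): the inward dilate of a point of `⋂ᵢ {θᵢ ≤ uᵢ}` lies in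
`⋂ᵢ ({θᵢ ≤ uᵢ} ∪ {(1−τ)θᵢ − τc₀ᵢ ≤ uᵢ < θᵢ})` — G20 `smul_mem_geCut_env` cut by cut. [textbook] -/
theorem smul_mem_biInter_geCut_env (M : Finset β) {u : β → X → ℝ} {c₀ θ : β → ℝ} {τ : ℝ} (hτ : τ ≤ 1)
    (hc₀ : ∀ i ∈ M, 0 ≤ c₀ i) (hθ : ∀ i ∈ M, 0 ≤ θ i)
    (hlow : ∀ i ∈ M, ∀ l ∈ Icc (1 - τ) 1, ∀ z, l * u i z - (1 - l) * c₀ i ≤ u i (l • z))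
    {l : ℝ} (hl : l ∈ Icc (1 - τ) 1) {z : X} (hz : z ∈ ⋂ i ∈ M, {x | θ i ≤ u i x}) :
    l • z ∈ ⋂ i ∈ M, ({x | θ i ≤ u i x} ∪ {x | (1 - τ) * θ i - τ * c₀ i ≤ u i x ∧ u i x < θ i}) := by
  simp only [mem_iInter] at hz ⊢
  exact fun i hi => smul_mem_geCut_env hτ (hc₀ i hi) (hθ i hi) (hlow i hi) hl (hz i hi)

/-- … hence in the intersection of the half-spaces `{(1−τ)θᵢ − τc₀ᵢ ≤ uᵢ}` — the envelope `⋂ᵢ Eᵢ` of §1∕§2 with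
`aᵢ := (1−τ)θᵢ − τc₀ᵢ`, `bᵢ := θᵢ` (for coordinate letters `uᵢ = xᵢ` the scaling is exact, `c₀ᵢ = 0`). [textbook] -/
theorem smul_mem_biInter_geCut_halfspace (M : Finset β) {u : β → X → ℝ} {c₀ θ : β → ℝ} {τ : ℝ} (hτ : τ ≤ 1)
    (hc₀ : ∀ i ∈ M, 0 ≤ c₀ i) (hθ : ∀ i ∈ M, 0 ≤ θ i)
    (hlow : ∀ i ∈ M, ∀ l ∈ Icc (1 - τ) 1, ∀ z, l * u i z - (1 - l) * c₀ i ≤ u i (l • z))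
    {l : ℝ} (hl : l ∈ Icc (1 - τ) 1) {z : X} (hz : z ∈ ⋂ i ∈ M, {x | θ i ≤ u i x}) :
    l • z ∈ ⋂ i ∈ M, {x | (1 - τ) * θ i - τ * c₀ i ≤ u i x} := by
  have h := smul_mem_biInter_geCut_env M hτ hc₀ hθ hlow hl hz
  simp only [mem_iInter, mem_union, mem_setOf_eq] at h ⊢
  intro i hi
  rcases h i hi with h1 | h2
  · have hτ0 : 0 ≤ τ := by linarith [hl.1, hl.2]
    nlinarith [hθ i hi, hc₀ i hi]
  · exact h2.1

end Geometry

/-! ## §4 A6 witness: the binders of §2 are jointly inhabited (Gaussian weight, two collar coordinates) -/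

section Witness

variable {ι : Type*} [Fintype ι] [DecidableEq ι]

omit [DecidableEq ι] in
/-- the Gaussian weight `e^{−Σᵢ xᵢ²∕2}` on `ℝ^ι` has finite mass (Mathlib: product of one-dimensional Gaussian
integrals). [textbook] -/
theorem isFiniteMeasure_gaussianWeight :
    IsFiniteMeasure (volume.withDensity fun x : ι → ℝ => ENNReal.ofReal (Real.exp (-(∑ i, x i ^ 2 / 2)))) := by
  have hint : Integrable (fun x : ι → ℝ => ∏ i, Real.exp (-(1 / 2) * x i ^ 2)) volume := by
    have h := Integrable.fintype_prod (μ := fun _ : ι => (volume : Measure ℝ))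
      (f := fun (_ : ι) (t : ℝ) => Real.exp (-(1 / 2) * t ^ 2))
      (fun _ => integrable_exp_neg_mul_sq (by norm_num))
    exact h
  have heq : (fun x : ι → ℝ => ENNReal.ofReal (Real.exp (-(∑ i, x i ^ 2 / 2))))
      = fun x => ENNReal.ofReal (∏ i, Real.exp (-(1 / 2) * x i ^ 2)) := by
    funext x
    rw [← Real.exp_sum, ← Finset.sum_neg_distrib]
    exact congrArg (fun t => ENNReal.ofReal (Real.exp t)) (Finset.sum_congr rfl fun i _ => by ring)
  rw [heq]
  exact isFiniteMeasure_withDensity_ofReal hint.hasFiniteIntegral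

/-- the Gaussian weight's action has one-sided partial slope `≤ 2` along any coordinate on the right
`½`-neighbourhoods of `[0, 1∕6)`. [textbook] -/
theorem gaussianWeight_partialSlope (p : ι) :
    ∀ x : ι → ℝ, ∀ y₁ ∈ Ico (0 : ℝ) (1 / 6), ∀ y₂ ∈ Icc y₁ (y₁ + (2 : ℝ)⁻¹),
      (∑ i, update x p y₂ i ^ 2 / 2) - (∑ i, update x p y₁ i ^ 2 / 2) ≤ 2 * (y₂ - y₁) := by
  intro x y₁ hy₁ y₂ hy₂
  have hdiff : (∑ i, update x p y₂ i ^ 2 / 2) - (∑ i, update x p y₁ i ^ 2 / 2) = (y₂ ^ 2 - y₁ ^ 2) / 2 := by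
    rw [← Finset.sum_sub_distrib, Finset.sum_eq_single p]
    · simp only [update_self]; ring
    · exact fun j _ hj => by rw [update_of_ne hj, update_of_ne hj, sub_self]
    · exact fun h => absurd (Finset.mem_univ p) h
  rw [hdiff]
  have h1 := hy₁.1; have h2 := hy₁.2; have h3 := hy₂.1; have h4 := hy₂.2
  nlinarith [mul_nonneg (sub_nonneg.2 h3) (show (0 : ℝ) ≤ 4 - y₁ - y₂ by norm_num at h4; linarith)]

/-- **A6 WITNESS** (director-ym STANDING A6 RULE №189 (3)): §2's END `collarOddsProduct_of_partialSlopes` APPLIED —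
Gaussian weight on `ℝ²`, both coordinates collar coordinates with left shell `[0, 1∕6)` below the cut `{1∕6 ≤ xᵢ}`,
slope `Λ = 2` (`c = e∕3 < 1`), rest event `univ` — every binder discharged in the kernel; a satisfiability witness,
not an estimate on Bałaban's measure. [textbook] -/
theorem collarOddsProduct_binders_inhabited :
    (volume.withDensity fun x : Fin 2 → ℝ => ENNReal.ofReal (Real.exp (-(∑ i, x i ^ 2 / 2))))
        ((⋂ i ∈ (Finset.univ : Finset (Fin 2)), {x : Fin 2 → ℝ | (0 : ℝ) ≤ x i}) ∩ univ)
      ≤ ENNReal.ofReal (∏ _i ∈ (Finset.univ : Finset (Fin 2)),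
            (1 + Real.exp 1 * 2 * ((1 : ℝ) / 6 - 0) / (1 - Real.exp 1 * 2 * ((1 : ℝ) / 6 - 0)))) *
        (volume.withDensity fun x : Fin 2 → ℝ => ENNReal.ofReal (Real.exp (-(∑ i, x i ^ 2 / 2))))
          ((⋂ i ∈ (Finset.univ : Finset (Fin 2)), {x : Fin 2 → ℝ | (1 : ℝ) / 6 ≤ x i}) ∩ univ) := by
  haveI := isFiniteMeasure_gaussianWeight (ι := Fin 2)
  have hA : Measurable fun x : Fin 2 → ℝ => ∑ i, x i ^ 2 / 2 :=
    Finset.measurable_sum _ fun i _ => ((measurable_pi_apply i).pow_const 2).div_const 2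
  have he : Real.exp 1 * 2 * ((1 : ℝ) / 6 - 0) < 1 := by nlinarith [Real.exp_one_lt_d9]
  exact collarOddsProduct_of_partialSlopes hA Finset.univ (a := fun _ => (0 : ℝ)) (b := fun _ => (1 : ℝ) / 6)
    (Λ := fun _ => (2 : ℝ)) (fun _ _ => by norm_num) (fun _ _ => by norm_num) (fun _ _ => he)
    (fun i _ => gaussianWeight_partialSlope i) MeasurableSet.univ (fun _ _ _ _ => by simp)

end Witness

end Summit.QuantumFields.YangMills.Theorems.N21CollarOddsProduct
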